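import Mathlib.NumberTheory.NumberField.Discriminant.Different
import Mathlib.RingTheory.DedekindDomain.AdicValuation
import HarnessLib

/-!
# A finite place whose square divides `(p)` divides the different — so off the (finite) ramified set, `(p)` is square-free at `w`
# ([Neukirch 1999] Ch. III Thm. (2.6): `𝔓 ∣ 𝔇 ⟺ e_𝔓 > 1`, the easy direction; [Serre, Corps locaux] Ch. III §6 Prop. 13)

Topic `NumberTheory/NumberFields`; namespace `Literature.NumberTheory.NumberFields`.  THEOREMS ONLY (no definition, no named fact, no instance,
no `sorry`).  Cell `hodgecm-mathlib` (D-0151), P6 «MOD programme»: the S-sized local step «`w ∉ Ram ⇒ ¬ w² ∣ (p)`» of desk F0P6a-plan (g4)'s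
(e1)∕(H1) cost sheet (2026-09-02T06:13Z) for the law field `pChar_unram : ¬ (w.asIdeal ^ 2 ∣ Ideal.span {(pChar : 𝓞 F)})`, whose exceptional
set is then the FINITE set `{w | w.asIdeal ∣ differentIdeal ℤ (𝓞 F)}` (★ `Automorphic.finite_setOf_dvd_differentIdeal`).  Mathlib supplies the
engine `pow_sub_one_dvd_differentIdeal` («`𝔓^e ∣ 𝔭𝒪_L ⇒ 𝔓^{e-1} ∣ 𝔇`»); this file is its `e = 2`, `A = ℤ` reading at a height-one prime of `𝓞 K`.
* `dvd_differentIdeal_of_sq_dvd_span_natCast` — `w² ∣ (p) ⇒ w ∣ 𝔇_{K∕ℚ}` (`p` prime);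
* `not_sq_dvd_span_natCast_of_not_dvd_differentIdeal` — the contrapositive, the shape of the law field;
* `finite_setOf_sq_dvd_span_natCast` — the set of finite places `w` with `w² ∣ (p)` for SOME prime `p` is finite.
`--supports stmt-HodgeConjecture-24832`, count-neutral; HC_CM is proved only modulo the printed citations until rung 0 closes.

## References
* [NeukirchANT1999] J. Neukirch, *Algebraic Number Theory* (1999), Ch. III §2 Thm. (2.6) p. 199 («`𝔓 ∣ 𝔇_{L|K}` iff `𝔓` is ramified»).
* [SerreLocalFields1979] J.-P. Serre, *Local Fields* (1979), Ch. III §6 Prop. 13 p. 58.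
-/

set_option autoImplicit false

namespace Literature.NumberTheory.NumberFields

open NumberField IsDedekindDomain

variable {K : Type*} [Field K] [NumberField K]

/-- **`w² ∣ (p) ⇒ w ∣ 𝔇_{K/ℚ}`** for a finite place `w` of the number field `K` and a rational prime `p`: Mathlib's
`pow_sub_one_dvd_differentIdeal` at `A = ℤ`, `𝔭 = (p)`, `e = 2` (the map of `(p) ⊂ ℤ` to `𝓞 K` is `(p)`).
[cite: NeukirchANT1999, Ch. III §2 Thm. (2.6) p. 199] [cite: SerreLocalFields1979, Ch. III §6 Prop. 13 p. 58] -/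
theorem dvd_differentIdeal_of_sq_dvd_span_natCast (w : HeightOneSpectrum (𝓞 K)) {p : ℕ} (hp : p.Prime)
    (h : w.asIdeal ^ 2 ∣ Ideal.span {(p : 𝓞 K)}) : w.asIdeal ∣ differentIdeal ℤ (𝓞 K) := by
  haveI : (Ideal.span {(p : ℤ)}).IsMaximal :=
    PrincipalIdealRing.isMaximal_of_irreducible (Int.prime_iff_natAbs_prime.2 (by simpa using hp)).irreducible
  have hp0 : Ideal.span {(p : ℤ)} ≠ ⊥ := by
    rw [Ne, Ideal.span_singleton_eq_bot]
    exact_mod_cast hp.ne_zero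
  have hmap : (Ideal.span {(p : ℤ)}).map (algebraMap ℤ (𝓞 K)) = Ideal.span {(p : 𝓞 K)} := by
    rw [Ideal.map_span, Set.image_singleton, map_natCast]
  have h2 := pow_sub_one_dvd_differentIdeal ℤ w.asIdeal 2 hp0 (by rwa [hmap])
  simpa using h2

/-- **Off the ramified set, `(p)` is square-free at `w`**: if `w ∤ 𝔇_{K/ℚ}` then `¬ w² ∣ (p)` for every rational prime `p` — the shape of the
law field `pChar_unram`. [cite: NeukirchANT1999, Ch. III §2 Thm. (2.6) p. 199] [cite: SerreLocalFields1979, Ch. III §6 Prop. 13 p. 58] -/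
theorem not_sq_dvd_span_natCast_of_not_dvd_differentIdeal (w : HeightOneSpectrum (𝓞 K)) {p : ℕ} (hp : p.Prime)
    (hw : ¬ w.asIdeal ∣ differentIdeal ℤ (𝓞 K)) : ¬ w.asIdeal ^ 2 ∣ Ideal.span {(p : 𝓞 K)} :=
  fun h => hw (dvd_differentIdeal_of_sq_dvd_span_natCast w hp h)

/-- **The places at which some `(p)` fails to be square-free form a FINITE set** (inside the prime factors of `𝔇_{K/ℚ} ≠ 0`; Mathlib
`differentIdeal_ne_bot`, `Ideal.finite_factors`). [cite: NeukirchANT1999, Ch. III §2 Thm. (2.6) p. 199 and (2.9) p. 201] -/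
theorem finite_setOf_sq_dvd_span_natCast :
    {w : HeightOneSpectrum (𝓞 K) | ∃ p : ℕ, p.Prime ∧ w.asIdeal ^ 2 ∣ Ideal.span {(p : 𝓞 K)}}.Finite := by
  refine (Ideal.finite_factors (differentIdeal_ne_bot (A := ℤ) (B := 𝓞 K))).subset ?_
  rintro w ⟨p, hp, h⟩
  exact dvd_differentIdeal_of_sq_dvd_span_natCast w hp h

end Literature.NumberTheory.NumberFields
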